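import Literature.Topology.FourManifolds.PlumbingOrientation
import Literature.AlgebraicTopology.FundamentalGroupoid.ThinComplementSimplyConnected
import Literature.AlgebraicTopology.FundamentalGroupoid.ThinRangeOfSmooth
import HarnessLib

/-!
# The interior of the plumbing minus the core spheres is simply connected (`k ≥ 3`)

Topic `Literature/Topology/FourManifolds` (fact seat of
`Literature.Topology.FourManifolds.HomotopySphere.exists_intersectionForm_equivalent_e8Form`,
Kosinski's `E₈` plumbing `M(4m)`, *Differential Manifolds* (1993), VI.12). Towards VI.(12.1)
(`π₁(∂M(4m)) = 1` for `k > 2`) in the form reduced by `PlumbingBoundaryReduction.lean`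
(`π₁({0 < ρ < ε₀}) = 1`): the first, general-position step. The eight core spheres
`κᵥ(p) = ιᵥ(p, p)` of the open plumbing `PV` (`PlumbingGlue.lean`) are smooth images of `Sᵏ` in
the `2k`-manifold `PV`, hence thin of codimension `k ≥ 3`, and removing them from the simply
connected open set `{ρ < ε}` (`Plumbing.isSimplyConnected_rho_lt`, `PlumbingOrientation.lean`)
leaves it simply connected (Hirsch 1976, Ch. 3 Thm. 2.5; tree:
`IsSimplyConnected.diff_thin`, `ThinComplementSimplyConnected.lean`).

* `Plumbing.contMDiff_core` — the core maps `Sᵏ → PV` are smooth;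
* `Plumbing.rho_core_le` — `ρ ≤ 0` on the cores;
* **`Plumbing.isSimplyConnected_rho_lt_diff_cores`** — `{ρ < ε} ∖ ⋃ᵥ κᵥ(Sᵏ)` is simply
  connected for `k ≥ 3`, `ε > 0`.

Everything is proved; no definitions, no named facts (D-0026).

## References

* A. Kosinski, *Differential Manifolds*, Academic Press 1993, VI.12, (12.1). [Kosinski1993]
* M. W. Hirsch, *Differential Topology*, GTM 33 (1976), Ch. 3 Thm. 2.5. [HirschDT1976]
-/

open scoped Manifold ContDiff Topology
open Set Function Topology TopologicalSpace Module

noncomputable section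

namespace Literature.Topology.FourManifolds

open Literature.AlgebraicTopology.FundamentalGroupoid

namespace Plumbing

variable {k n : ℕ} {c : ℝ} (hk : 2 ≤ k) (hc : IsParam c) (hkn : k + k = n + 1)

/-- The diagonal map `p ↦ (p, p)` into the tube is smooth. [folklore] -/
theorem contMDiff_diagPt' (hc1 : c < 1) :
    ContMDiff (𝓡 k) ((𝓡 k).prod (𝓡 k)) ∞
      (fun p : Metric.sphere (0 : EuclideanSpace ℝ (Fin (k + 1))) 1 => diagPt hc1 p) := by
  intro p
  rw [← ContMDiffAt.subtypeVal_comp_iff (Tb k c) (fun p => diagPt hc1 p) p]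
  exact (contMDiff_id.prodMk contMDiff_id).contMDiffAt

/-- **The core maps `κᵥ(p) = ιᵥ(p, p) : Sᵏ → PV` are smooth.** [cite: Kosinski1993, VI.12 p. 120] -/
theorem contMDiff_core (v : Fin 8) :
    ContMDiff (𝓡 k) (𝓡 (n + 1)) ∞
      (fun p : Metric.sphere (0 : EuclideanSpace ℝ (Fin (k + 1))) 1 =>
        ι hk hc hkn v (diagPt hc.lt_one p)) :=
  (contMDiff_ι hk hc hkn v).comp (contMDiff_diagPt' hc.lt_one)

include hc in
/-- **`ρ ≤ 0` on the cores.** [folklore] -/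
theorem rho_core_le (v : Fin 8) (p : Metric.sphere (0 : EuclideanSpace ℝ (Fin (k + 1))) 1) :
    rho hk hc hkn (ι hk hc hkn v (diagPt hc.lt_one p)) ≤ 0 := by
  rw [rho_ι]; exact rhoHat_diagPt_le hc v p

/-- **The interior of the plumbing minus the cores is simply connected** (`k ≥ 3`, `ε > 0`):
`{ρ < ε} ∖ ⋃ᵥ κᵥ(Sᵏ)` — the cores are thin of codimension `k ≥ 3` (smooth images of `Sᵏ` in the
`2k`-manifold `PV`) in the simply connected open set `{ρ < ε}` (Hirsch Ch. 3 Thm. 2.5,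
`IsSimplyConnected.diff_thin`; the complement is nonempty since `ρ ≤ 0` on the cores while
`ρ` takes every small positive value). [cite: HirschDT1976, Ch. 3 Thm. 2.5] [cite: Kosinski1993, VI.(12.1)] -/
theorem isSimplyConnected_rho_lt_diff_cores (hk3 : 3 ≤ k) {ε : ℝ} (hε : 0 < ε) :
    IsSimplyConnected ({p : PV k c hk hc hkn | rho hk hc hkn p < ε} \
      ⋃ v : Fin 8, range (fun p : Metric.sphere (0 : EuclideanSpace ℝ (Fin (k + 1))) 1 =>
        ι hk hc hkn v (diagPt hc.lt_one p))) := by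
  classical
  -- thin covers of the eight cores
  have hcov : ∀ v : Fin 8, ∃ (m : ℕ) (O : Fin m → Set (Fin k → ℝ))
      (G : Fin m → (Fin k → ℝ) → PV k c hk hc hkn),
      (∀ j, IsOpen (O j)) ∧ (∀ j, ContMDiffOn 𝓘(ℝ, Fin k → ℝ) (𝓡 (n + 1)) 1 (G j) (O j)) ∧
      range (fun p : Metric.sphere (0 : EuclideanSpace ℝ (Fin (k + 1))) 1 =>
          ι hk hc hkn v (diagPt hc.lt_one p)) ⊆ ⋃ j, G j '' O j :=
    fun v => exists_thin_cover_range_of_contMDiff ((contMDiff_core hk hc hkn v).of_le (by simp))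
  choose m O G hO hG hCG using hcov
  -- the combined cover, indexed by `Σ v, Fin (m v)`
  set C : Set (PV k c hk hc hkn) := ⋃ v : Fin 8,
    range (fun p : Metric.sphere (0 : EuclideanSpace ℝ (Fin (k + 1))) 1 =>
      ι hk hc hkn v (diagPt hc.lt_one p)) with hC
  have hCc : IsCompact C :=
    isCompact_iUnion fun v => isCompact_range (contMDiff_core hk hc hkn v).continuous
  have hCint : ∀ x ∈ C, (𝓡 (n + 1)).IsInteriorPoint x := fun x _ =>
    BoundarylessManifold.isInteriorPoint (I := 𝓡 (n + 1))
  have hCcov : C ⊆ ⋃ ji : Σ v : Fin 8, Fin (m v), G ji.1 ji.2 '' O ji.1 ji.2 := by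
    intro x hx
    obtain ⟨v, hv⟩ := mem_iUnion.1 hx
    obtain ⟨j, hj⟩ := mem_iUnion.1 (hCG v hv)
    exact mem_iUnion.2 ⟨⟨v, j⟩, hj⟩
  have hdim : k + 2 < finrank ℝ (EuclideanSpace ℝ (Fin (n + 1))) := by
    rw [finrank_euclideanSpace_fin]; omega
  have hUo : IsOpen {p : PV k c hk hc hkn | rho hk hc hkn p < ε} :=
    isOpen_lt (continuous_rho hk hc hkn) continuous_const
  have hUsc : IsSimplyConnected {p : PV k c hk hc hkn | rho hk hc hkn p < ε} :=
    isSimplyConnected_rho_lt hk hc hkn hε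
  -- a point with `0 < ρ < ε` is off the cores
  have hne : ({p : PV k c hk hc hkn | rho hk hc hkn p < ε} \ C).Nonempty := by
    set t : ℝ := min (ε / 2) (epsMax c) with ht
    have ht0 : 0 < t := lt_min (by linarith) (epsMax_pos hc)
    have htR : t < rsq c := by
      have h1 := min_le_right (ε / 2) (epsMax c)
      have h2 := rsq_pos hc
      rw [ht]; rw [epsMax] at h1 ⊢; linarith
    obtain ⟨p, hp⟩ := exists_rho_eq hk hc hkn ht0 htR
    refine ⟨p, ?_, fun hpC => ?_⟩
    · change rho hk hc hkn p < ε
      have := min_le_left (ε / 2) (epsMax c); rw [hp]; linarith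
    · obtain ⟨v, hv⟩ := mem_iUnion.1 hpC
      obtain ⟨q, rfl⟩ := hv
      have := rho_core_le hk hc hkn v q
      linarith
  exact IsSimplyConnected.diff_thin (J := 𝓡 (n + 1)) (fun ji : Σ v : Fin 8, Fin (m v) => O ji.1 ji.2)
    (fun ji => G ji.1 ji.2) (fun ji => hO ji.1 ji.2) (fun ji => hG ji.1 ji.2) hdim hCc hCint hCcov
    hUo hUsc hne

end Plumbing

end Literature.Topology.FourManifolds
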